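/-
Copyright: cell pub-balaban-gaps (YM BLITZ Y1, track G1).  Statements and proofs of §§1–2 typed by seat g1-plan-1 (skeleton
`g1/skeletons/D4NodeB3AxialResidue.lean` sha16 8c4ac34c85b49cfd, «FIRST LANDABLE WORK» handed to g1-p2, G1-PLAN-D4.md v1.1 §7 (b));
§3 (the axial contour system of a cube, CONSTRUCTED, discharging the skeleton's `stub_contour_length`) and §4 by seat g1-p2
(unit `pub-balaban-gaps-g1-p2-g0`).  HONEST FRAMING: bookkeeping over the landed abstract transport lemmas of `B11AxialTransport190`;
nothing of Bałaban's is asserted beyond print; binder (D4) is NOT discharged; NODE B.3 waits on NODE O (the minimiser as a term) for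
its INSTANCE; NOT B12 Thm 2, NOT BetaPertH, NOT continuum, NOT Clay.
-/
import Mathlib
import Literature.MathematicalPhysics.QuantumFieldTheory.Balaban1983to89.B11AxialTransport190

/-!
# `Gaps.D4NodeB3AxialResidue` — (D4) NODE B.3: the residue (R-a) «|u_{k+1} − 1| < B₃·O(1)·M·α₀ on □₀» as a corollary of the
# landed axial transport lemma, with the cube's axial CONTOUR SYSTEM constructed (cell pub-balaban-gaps, track G1, seats g1-plan-1 / g1-p2)

HONEST DEPENDENCY (cell pub-balaban, verbatim): continuum YM on T⁴ ⇐ BetaPertH ∧ nine spine estimates (0/9 proved);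
BetaPertH ⇐ (D1) ∧ (D4) ∧ CAP+tail.

WHERE THIS SITS (row D4 owner's skeleton `beta/skeletons/D4-b2b-balaban-beta-an4.md` §2 NODE B.3, class LOCATED-ROUTINE, swarm-ready
(w2), UNOWNED; cell plan `g1/G1-PLAN-D4.md` v1.1 §3.2/§7 (b)).  Row D4's socket field `Data190` / the (4.4)-seam of [I] p. 281 is built
on the AXIAL-gauge minimiser; [15]'s (190) is proved in the LANDAU gauge; the transfer Landau → axial is `B11AxialTransport190`
(Parts II–V, kernel, p184253), and the one residue NODE B.3 leaves is the smallness of the axialising gauge transformation itself on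
the cube: along every axial contour Γ rooted at the cube's base point (u = 1 there), `|u(x) − 1| ≤ Σ_bonds |U₁(b) − 1|`
(`B11AxialTransport190.dist1_transport_le`), hence ≤ (length Γ)·(max bond deviation) ≤ O(1)·M·B₃α₀.

## What is here (kernel-checked, 0 sorry)

* §1 `dist1_transport_le_mul`, `dist1_transport_le_length_mul` — root value 1 + per-bond deviation `η` ⟹ `|u − 1| ≤ n·η` along an
  axialised contour (g1-plan-1).
* §2 `ContourSystem` (abstract: base point, a path to every site of the cube, its length) and `residue_Ra`: contour lengths ≤ `C_Γ·M`
  and bond deviations ≤ `B₃α₀` ⟹ `|u(x) − 1| ≤ C_Γ·M·B₃·α₀` on the cube (g1-plan-1).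
* §3 THE AXIAL CONTOUR SYSTEM OF THE CUBE `{0,…,M−1}^d ⊂ ℤ^d`, CONSTRUCTED (g1-p2): the staircase path from the corner `0` to `x`
  filling the coordinates in the fixed order `0, 1, …, d−1` ([B7] after (76) p. 29: straight segments along the axes in a fixed
  order), `axialContours d M : ContourSystem (Fin d → ℤ) (cube d M)`, with `len x = Σ_i x_i ≤ d·M` (`axialContours_len_le`) — the
  skeleton's `stub_contour_length` DISCHARGED BY CONSTRUCTION — and the geometric clauses `axialContours_coord_mono` /
  `axialContours_coord_step_le_one` (each coordinate is non-decreasing along the path and moves by at most one unit per step) and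
  §3b `sum_staircase` / `staircase_unit_step`: the coordinates add up to `min n (Σ_i x_i)`, so EXACTLY ONE coordinate moves by one unit
  per step — consecutive sites of a contour are nearest neighbours (the «bonds» are lattice bonds).
* §4 `residue_Ra_cube`: (R-a) on Bałaban's cube with the constructed contours — `|u(x) − 1| ≤ d·M·(B₃α₀)` for every site — from
  the axiality of `relAct u U₁ U₀` along the contours, `u(0) = 1`, and the ONE remaining printed input as a NAMED HYPOTHESIS `hdev`:
  the per-bond deviation `|U₁(b) − 1| ≤ B₃α₀` of the Landau-gauge fine variables of the restricted minimiser ([I] (3.26)–(3.27)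
  p. 275 / [15] Sect. F (148)–(153) p. 301) — whose INSTANCE quantifies over the minimiser (NODE O) and is not in the tree.

## What is NOT here

No minimiser, no instance of `hdev`, no claim about Bałaban's (190) beyond the typed transfer; the skeleton's second stub
(`stub_bondDev_of_326`) is kept as the hypothesis `hdev`, not asserted.  No `sorry`, no axiom beyond the standard trio.
-/

namespace Summit.QuantumFields.BalabanUV.Gaps.D4NodeB3AxialResidue

open Literature.MathematicalPhysics.QuantumFieldTheory.Balaban1983to89
open Literature.MathematicalPhysics.QuantumFieldTheory.Balaban1983to89.B11AxialTransport190
open Finset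

variable {G : Type*} [GaugeGroup G] {X : Type*}

/-! ## §1 The transport corollary (kernel): root value 1 + per-bond deviation η ⟹ |u − 1| ≤ n·η along Γ -/

/-- **|u − 1| ALONG AN AXIALISED CONTOUR, QUANTIFIED.**  If `U′ = relAct u U₁ U₀` is axial along the path `γ` for `N`
bonds, `u(γ₀) = 1` (the axial gauge is rooted at the contour's base point) and every Landau bond variable on the path
deviates from 1 by at most `η`, then `dist1 (u (γ n)) ≤ n·η` for every `n ≤ N` (typed by g1-plan-1).
[cite: Balaban1985Averaging, (73) p.29; Balaban1985Variational, (16) p.280] -/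
theorem dist1_transport_le_mul (u : X → G) (U₁ U₀ : X → X → G) (γ : ℕ → X) {N : ℕ}
    (h : PathAxial (relAct u U₁ U₀) γ N) (hroot : u (γ 0) = 1) {η : ℝ}
    (hdev : ∀ i < N, dist1 (U₁ (γ i) (γ (i + 1))) ≤ η) :
    ∀ n ≤ N, dist1 (u (γ n)) ≤ n * η := by
  intro n hn
  have ht := dist1_transport_le u U₁ U₀ γ h n hn
  rw [hroot, GaugeGroup.dist1_one, zero_add] at ht
  have hsum : ∑ i ∈ Finset.range n, dist1 (U₁ (γ i) (γ (i + 1))) ≤ ∑ _i ∈ Finset.range n, η :=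
    Finset.sum_le_sum fun i hi => hdev i (lt_of_lt_of_le (Finset.mem_range.1 hi) hn)
  rw [Finset.sum_const, Finset.card_range, nsmul_eq_mul] at hsum
  exact ht.trans hsum

/-- Uniform form: `dist1 (u (γ n)) ≤ N·η` on the whole contour (η ≥ 0) (typed by g1-plan-1). [folklore] -/
theorem dist1_transport_le_length_mul (u : X → G) (U₁ U₀ : X → X → G) (γ : ℕ → X) {N : ℕ}
    (h : PathAxial (relAct u U₁ U₀) γ N) (hroot : u (γ 0) = 1) {η : ℝ} (hη : 0 ≤ η)
    (hdev : ∀ i < N, dist1 (U₁ (γ i) (γ (i + 1))) ≤ η) :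
    ∀ n ≤ N, dist1 (u (γ n)) ≤ N * η := fun n hn =>
  (dist1_transport_le_mul u U₁ U₀ γ h hroot hdev n hn).trans
    (mul_le_mul_of_nonneg_right (Nat.cast_le.2 hn) hη)

/-! ## §2 The residue (R-a) in the letters of NODE B.3: contour length ≤ C_Γ·M, bond deviation ≤ B₃·α₀ -/

/-- **A CONTOUR SYSTEM for a cube** (abstract): to every site `x` of the cube a lattice path `Γ x` from the base point
(`Γ x 0 = x₀`) to `x` (`Γ x (len x) = x`) of length `len x` — the shape of [B7]'s axial-gauge contours Γ_{y,x} / [14] (0.11)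
(typed by g1-plan-1; the instance for the cube `{0,…,M−1}^d` is §3's `axialContours`). [cite: Balaban1985Averaging, (73) p.29] -/
structure ContourSystem (X : Type*) (Cube : Set X) where
  /-- the base point of the cube -/
  x₀ : X
  /-- the contour to each site, as a sequence of sites -/
  Γ : X → ℕ → X
  /-- the number of bonds of the contour to each site -/
  len : X → ℕ
  /-- every contour starts at the base point -/
  base : ∀ x ∈ Cube, Γ x 0 = x₀
  /-- the contour to `x` ends at `x` -/
  tip : ∀ x ∈ Cube, Γ x (len x) = x

/-- **THE RESIDUE (R-a) OF NODE B.3, typed**: on a cube with a contour system of lengths ≤ `C_Γ·M`, an axialising gauge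
transformation rooted at the base point (u(x₀) = 1) of Landau variables within `B₃·α₀` of 1 on the contours satisfies
`|u(x) − 1| ≤ C_Γ·M·B₃·α₀` at every site of the cube (typed by g1-plan-1).
[cite: Balaban1987RG1, (3.26)-(3.27) p.275; Balaban1985Variational, (148)-(153) p.301] -/
theorem residue_Ra {Cube : Set X} (K : ContourSystem X Cube) (u : X → G) (U₁ U₀ : X → X → G)
    (hax : ∀ x ∈ Cube, PathAxial (relAct u U₁ U₀) (K.Γ x) (K.len x)) (hroot : u K.x₀ = 1)
    {CΓ B₃ α₀ : ℝ} {M : ℕ} (hB : 0 ≤ B₃ * α₀) (hlen : ∀ x ∈ Cube, (K.len x : ℝ) ≤ CΓ * M)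
    (hdev : ∀ x ∈ Cube, ∀ i < K.len x, dist1 (U₁ (K.Γ x i) (K.Γ x (i + 1))) ≤ B₃ * α₀) :
    ∀ x ∈ Cube, dist1 (u x) ≤ CΓ * M * (B₃ * α₀) := by
  intro x hx
  have hroot' : u (K.Γ x 0) = 1 := by rw [K.base x hx]; exact hroot
  have h := dist1_transport_le_length_mul u U₁ U₀ (K.Γ x) (hax x hx) hroot' hB (hdev x hx) (K.len x) le_rfl
  rw [K.tip x hx] at h
  exact h.trans (mul_le_mul_of_nonneg_right (hlen x hx) hB)

/-! ## §3 The axial contour system of the cube `{0,…,M−1}^d ⊂ ℤ^d`, CONSTRUCTED (g1-p2) -/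

section Cube

variable (d M : ℕ)

/-- The cube `{0,…,M−1}^d` of side `M` with corner `0` in `ℤ^d` ([I] p. 257: the cubes □ of the partitions).
[cite: Balaban1987RG1, (0.25) p.257] -/
def cube : Set (Fin d → ℤ) := {x | ∀ i, 0 ≤ x i ∧ x i < M}

variable {d M}

/-- The prefix sum `S_i(x) = Σ_{j<i} x_j` of the coordinates (the number of bonds spent on the axes `0,…,i−1`). [folklore] -/
def prefixSum (x : Fin d → ℤ) (i : Fin d) : ℤ := ∑ j ∈ Finset.univ.filter (fun j : Fin d => j < i), x j

/-- The total `Σ_i x_i` of the coordinates (the length of the staircase contour to `x`, as an integer). [folklore] -/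
def total (x : Fin d → ℤ) : ℤ := ∑ j, x j

/-- **THE STAIRCASE CONTOUR** from the corner `0` to `x`: after `n` bonds the `i`-th coordinate is `clamp(n − S_i(x); 0, x_i)` —
the axes are filled in the fixed order `0, 1, …, d−1`, each by a straight segment ([B7] after (76) p. 29). [cite: Balaban1985Averaging, p.29 (after (76))] -/
def staircase (x : Fin d → ℤ) (n : ℕ) : Fin d → ℤ := fun i => max 0 (min (x i) ((n : ℤ) - prefixSum x i))

/-- The length of the staircase contour to `x`: `Σ_i x_i` as a natural number (coordinates are non-negative on the cube). [folklore] -/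
def stairLen (x : Fin d → ℤ) : ℕ := (total x).toNat

/-- Prefix sums of a point of the cube are non-negative. [folklore] -/
theorem prefixSum_nonneg {x : Fin d → ℤ} (hx : x ∈ cube d M) (i : Fin d) : 0 ≤ prefixSum x i :=
  Finset.sum_nonneg fun j _ => (hx j).1

/-- The total of a point of the cube is non-negative. [folklore] -/
theorem total_nonneg {x : Fin d → ℤ} (hx : x ∈ cube d M) : 0 ≤ total x :=
  Finset.sum_nonneg fun j _ => (hx j).1

/-- On the cube, `x_i + S_i(x) ≤ Σ_j x_j` (the bonds of axis `i` fit after those of the earlier axes). [folklore] -/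
theorem add_prefixSum_le_total {x : Fin d → ℤ} (hx : x ∈ cube d M) (i : Fin d) : x i + prefixSum x i ≤ total x := by
  classical
  unfold prefixSum total
  have hsplit : ∑ j, x j = ∑ j ∈ Finset.univ.filter (fun j : Fin d => j < i), x j +
      ∑ j ∈ Finset.univ.filter (fun j : Fin d => ¬ j < i), x j :=
    (Finset.sum_filter_add_sum_filter_not _ _ _).symm
  have hi : i ∈ Finset.univ.filter (fun j : Fin d => ¬ j < i) := by simp
  have hrest : x i ≤ ∑ j ∈ Finset.univ.filter (fun j : Fin d => ¬ j < i), x j :=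
    Finset.single_le_sum (fun j _ => (hx j).1) hi
  linarith

/-- **BASE**: the staircase starts at the corner `0`. [folklore] -/
theorem staircase_zero {x : Fin d → ℤ} (hx : x ∈ cube d M) : staircase x 0 = 0 := by
  funext i
  have hS := prefixSum_nonneg hx i
  simp only [staircase, Nat.cast_zero, zero_sub, Pi.zero_apply]
  exact max_eq_left ((min_le_right _ _).trans (neg_nonpos.mpr hS))

/-- **TIP**: after `Σ_i x_i` bonds the staircase is at `x`. [folklore] -/
theorem staircase_stairLen {x : Fin d → ℤ} (hx : x ∈ cube d M) : staircase x (stairLen x) = x := by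
  funext i
  have hT : ((stairLen x : ℕ) : ℤ) = total x := by
    simp only [stairLen, Int.toNat_of_nonneg (total_nonneg hx)]
  have h1 : x i ≤ (stairLen x : ℤ) - prefixSum x i := by
    rw [hT]; linarith [add_prefixSum_le_total hx i]
  simp only [staircase, min_eq_left h1]
  exact max_eq_right (hx i).1

/-- **LENGTH**: `Σ_i x_i ≤ d·M` on the cube (indeed `≤ d·(M−1)`). [cite: Balaban1985Averaging, p.29 (after (76))] -/
theorem stairLen_le {x : Fin d → ℤ} (hx : x ∈ cube d M) : (stairLen x : ℝ) ≤ d * M := by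
  have hT : ((stairLen x : ℕ) : ℤ) = total x := by
    simp only [stairLen, Int.toNat_of_nonneg (total_nonneg hx)]
  have hle : total x ≤ d * M := by
    unfold total
    calc ∑ j, x j ≤ ∑ _j : Fin d, (M : ℤ) := Finset.sum_le_sum fun j _ => (hx j).2.le
      _ = d * M := by simp
  have hZ : ((stairLen x : ℕ) : ℤ) ≤ d * M := hT ▸ hle
  exact_mod_cast hZ

/-- **THE AXIAL CONTOUR SYSTEM OF THE CUBE** `{0,…,M−1}^d`: base point the corner `0`, contours the staircases, lengths `Σ_i x_i`
— the skeleton's `ContourSystem` INSTANTIATED. [cite: Balaban1985Averaging, (73) p.29 and p.29 (after (76))] -/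
def axialContours (d M : ℕ) : ContourSystem (Fin d → ℤ) (cube d M) where
  x₀ := 0
  Γ := staircase
  len := stairLen
  base := fun _ hx => staircase_zero hx
  tip := fun _ hx => staircase_stairLen hx

/-- **The skeleton's `stub_contour_length`, DISCHARGED BY CONSTRUCTION**: every axial contour of the cube of side `M` has at most
`d·M` bonds. [cite: Balaban1985Averaging, p.29 (after (76))] -/
theorem axialContours_len_le (d M : ℕ) : ∀ x ∈ cube d M, ((axialContours d M).len x : ℝ) ≤ d * M :=
  fun _ hx => stairLen_le hx

/-- Geometric clause (i): along the staircase every coordinate is NON-DECREASING in the step count. [folklore] -/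
theorem axialContours_coord_mono (x : Fin d → ℤ) (i : Fin d) : Monotone fun n : ℕ => staircase x n i := by
  intro m n hmn
  simp only [staircase]
  have : (m : ℤ) - prefixSum x i ≤ (n : ℤ) - prefixSum x i := by
    have : (m : ℤ) ≤ n := by exact_mod_cast hmn
    linarith
  exact max_le_max le_rfl (min_le_min le_rfl this)

/-- Geometric clause (ii): along the staircase every coordinate moves by AT MOST ONE unit per step (so consecutive sites differ
by a unit step of the lattice in the coordinates that move). [folklore] -/
theorem axialContours_coord_step_le_one (x : Fin d → ℤ) (i : Fin d) (n : ℕ) :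
    staircase x (n + 1) i ≤ staircase x n i + 1 := by
  simp only [staircase, Nat.cast_add, Nat.cast_one]
  have h1 : min (x i) ((n : ℤ) + 1 - prefixSum x i) ≤ min (x i) ((n : ℤ) - prefixSum x i) + 1 := by
    rcases le_total (x i) ((n : ℤ) - prefixSum x i) with h | h
    · rw [min_eq_left h, min_eq_left (by linarith)]; linarith
    · rw [min_eq_right h]
      exact (min_le_right _ _).trans (by linarith)
  rcases le_total 0 (min (x i) ((n : ℤ) - prefixSum x i)) with h0 | h0
  · rw [max_eq_right h0]
    exact max_le (by linarith) h1
  · rw [max_eq_left h0]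
    exact max_le (by norm_num) (h1.trans (by linarith))

/-! ### §3b The staircase moves by EXACTLY ONE lattice unit per step (consecutive sites are nearest neighbours) -/

/-- The ℕ-indexed prefix sums `S_k(x) = Σ_{j<k} x_j` (`k` may exceed `d`). [folklore] -/
def pSum (x : Fin d → ℤ) (k : ℕ) : ℤ := ∑ j : Fin d, if (j : ℕ) < k then x j else 0

/-- `prefixSum x i = S_i(x)`. [folklore] -/
theorem prefixSum_eq_pSum (x : Fin d → ℤ) (i : Fin d) : prefixSum x i = pSum x i := by
  unfold prefixSum pSum
  rw [Finset.sum_filter]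
  refine Finset.sum_congr rfl fun j _ => ?_
  by_cases h : j < i
  · have h2 : (j : ℕ) < (i : ℕ) := h
    simp [h, h2]
  · have h2 : ¬ (j : ℕ) < (i : ℕ) := h
    simp [h, h2]

/-- `S_0 = 0`. [folklore] -/
theorem pSum_zero (x : Fin d → ℤ) : pSum x 0 = 0 := by
  simp [pSum]

/-- `S_d = Σ_j x_j`. [folklore] -/
theorem pSum_d (x : Fin d → ℤ) : pSum x d = total x := by
  unfold pSum total
  exact Finset.sum_congr rfl fun j _ => by simp [j.is_lt]

/-- `S_{i+1} = S_i + x_i` for `i < d`. [folklore] -/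
theorem pSum_succ (x : Fin d → ℤ) (i : Fin d) : pSum x ((i : ℕ) + 1) = pSum x i + x i := by
  unfold pSum
  have hpt : ∀ j : Fin d, (if (j : ℕ) < (i : ℕ) + 1 then x j else 0) =
      (if (j : ℕ) < (i : ℕ) then x j else 0) + (if j = i then x j else 0) := by
    intro j
    by_cases hji : j = i
    · subst hji; simp
    · have hne : (j : ℕ) ≠ (i : ℕ) := fun h => hji (Fin.ext h)
      by_cases hlt : (j : ℕ) < (i : ℕ)
      · simp [hlt, hji, Nat.lt_succ_of_lt hlt]
      · have : ¬ (j : ℕ) < (i : ℕ) + 1 := by omega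
        simp [hlt, hji, this]
  rw [Finset.sum_congr rfl fun j _ => hpt j, Finset.sum_add_distrib, Finset.sum_ite_eq' Finset.univ i]
  simp

/-- The clamp identity behind the staircase: for `a ≥ 0`, `max 0 (min a (t − S)) = min t (S + a) − min t S`. [folklore] -/
theorem clamp_eq_min_sub_min (t S a : ℤ) (ha : 0 ≤ a) : max 0 (min a (t - S)) = min t (S + a) - min t S := by
  omega

/-- **THE STAIRCASE'S COORDINATE SUM**: after `n` steps the coordinates of the staircase to a point `x` of the cube add up to
`min n (Σ_i x_i)` (telescoping of `clamp_eq_min_sub_min` along `S_{i+1} = S_i + x_i`). [folklore] -/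
theorem sum_staircase {x : Fin d → ℤ} (hx : x ∈ cube d M) (n : ℕ) : ∑ i, staircase x n i = min (n : ℤ) (total x) := by
  have hterm : ∀ i : Fin d, staircase x n i = min (n : ℤ) (pSum x ((i : ℕ) + 1)) - min (n : ℤ) (pSum x i) := by
    intro i
    simp only [staircase, prefixSum_eq_pSum, pSum_succ]
    exact clamp_eq_min_sub_min _ _ _ (hx i).1
  rw [Finset.sum_congr rfl fun i _ => hterm i,
    Fin.sum_univ_eq_sum_range (fun k => min (n : ℤ) (pSum x (k + 1)) - min (n : ℤ) (pSum x k)) d,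
    Finset.sum_range_sub (fun k => min (n : ℤ) (pSum x k)) d, pSum_d, pSum_zero, min_eq_right (by positivity : (0 : ℤ) ≤ n),
    sub_zero]

/-- **EXACTLY ONE UNIT PER STEP**: along the staircase to `x ∈ cube`, for every step `n < Σ_i x_i` the coordinate increments are
non-negative integers, each at most one, adding up to ONE — so consecutive sites are nearest neighbours of the lattice `ℤ^d` and the
«bonds» of §4 are lattice bonds ([B7] p. 29: straight segments along the axes). [cite: Balaban1985Averaging, p.29 (after (76))] -/
theorem staircase_unit_step {x : Fin d → ℤ} (hx : x ∈ cube d M) {n : ℕ} (hn : n < stairLen x) :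
    (∑ i, (staircase x (n + 1) i - staircase x n i)) = 1 ∧
      ∀ i, 0 ≤ staircase x (n + 1) i - staircase x n i ∧ staircase x (n + 1) i - staircase x n i ≤ 1 := by
  refine ⟨?_, fun i => ⟨sub_nonneg.mpr (axialContours_coord_mono x i (Nat.le_succ n)),
    by linarith [axialContours_coord_step_le_one x i n]⟩⟩
  have hL : ((stairLen x : ℕ) : ℤ) = total x := by simp only [stairLen, Int.toNat_of_nonneg (total_nonneg hx)]
  have hn' : (n : ℤ) + 1 ≤ total x := by
    have : (n : ℤ) + 1 ≤ (stairLen x : ℤ) := by exact_mod_cast hn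
    rwa [hL] at this
  rw [Finset.sum_sub_distrib, sum_staircase hx, sum_staircase hx, Nat.cast_add, Nat.cast_one,
    min_eq_left hn', min_eq_left (by linarith)]
  ring

end Cube

/-! ## §4 (R-a) on Bałaban's cube with the constructed contours; the per-bond deviation stays a NAMED HYPOTHESIS -/

/-- **(R-a) ON THE CUBE `{0,…,M−1}^d` WITH ITS AXIAL CONTOURS**: if `relAct u U₁ U₀` is axial along every staircase contour, `u` is
rooted at the corner (`u 0 = 1`), and — the one remaining printed input, a HYPOTHESIS here — the Landau-gauge fine bond variables of the
restricted minimiser deviate from 1 by at most `B₃α₀` on the contour bonds ([I] (3.26)–(3.27) p. 275; [15] Sect. F (148)–(153) p. 301;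
the skeleton's `stub_bondDev_of_326`, whose instance quantifies over the minimiser = NODE O), then `|u(x) − 1| ≤ d·M·(B₃α₀)` at every
site of the cube: the owner's NODE B.3 residue «|u_{k+1} − 1| < B₃·O(1)·M·α₀ on □₀» with `O(1) = d`, contour length discharged.
[cite: Balaban1987RG1, (3.26)-(3.27) p.275; Balaban1985Variational, (148)-(153) p.301; Balaban1985Averaging, (73) p.29] -/
theorem residue_Ra_cube (d M : ℕ) (u : (Fin d → ℤ) → G) (U₁ U₀ : (Fin d → ℤ) → (Fin d → ℤ) → G)
    (hax : ∀ x ∈ cube d M, PathAxial (relAct u U₁ U₀) (staircase x) (stairLen x)) (hroot : u 0 = 1) {B₃ α₀ : ℝ}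
    (hB : 0 ≤ B₃ * α₀)
    (hdev : ∀ x ∈ cube d M, ∀ i < stairLen x, dist1 (U₁ (staircase x i) (staircase x (i + 1))) ≤ B₃ * α₀) :
    ∀ x ∈ cube d M, dist1 (u x) ≤ d * M * (B₃ * α₀) :=
  residue_Ra (axialContours d M) u U₁ U₀ hax hroot hB (axialContours_len_le d M) hdev

end Summit.QuantumFields.BalabanUV.Gaps.D4NodeB3AxialResidue
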